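import Literature.Probability.Percolation.TriInnerApproxMarksLimit
import Literature.Probability.RandomPlanarGeometry.CollarGeometry
import HarnessLib

/-!
# The discrete approximations at a fixed level

Topic `Literature/Probability/Percolation`; family `crit-perc`. For a conformal rectangle `R` with
anticlockwise boundary, tube data `T` and a sign pattern `σ ∈ {±1}⁴`, and for a *level* `ε > 0`,
we fix a collar domain `D_σ = collarRect R T σ h` of small width `h = h(ε)` (`CollarDomain.lean`)
and, for every small mesh `δ`, a 4-marked inner approximation `G` of `D_σ` (the marked domain of
`exists_marked_innerApprox`, `TriInnerApproxMarksLimit.lean`). This file proves the level-`ε`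
properties of `G` relative to `R` that feed Lemma 14 of Bollobás–Riordan, *Percolation* (2006),
Ch. 7 (p. 184; (28)–(29) p. 192, (31)–(34) pp. 196–199): its discrete arcs are within `2ε` of the
arcs of `R` and conversely; its sites off `Ω` hug the pushed-out arcs, its sites in `Ω` away from
the corners keep off the pulled-in arcs, its pushed-out discrete arcs lie off `Ω` (the pointwise
hypotheses of `TriMarkedSandwich.lean`); the mesh points of the compact `Φ(B̄(0, 1 - 2ε))` are
sites; and every point of `closure Ω` is within `2ε` of the centre of a face of `G`
(`level_core`).

## References

* B. Bollobás, O. Riordan, *Percolation*, Cambridge University Press (2006), Ch. 7 Lemma 14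
  p. 184, pp. 186, 192, 196–199.

## Mathlib / tree

Tree: `TriInnerApproxMarksLimit` (`exists_marked_innerApprox`, `exists_face_near`),
`TriInnerApproxLimit` (`exists_forall_mem_innerApprox`, `closedBall_subset_of_lt_infDist_frontier`),
`TriInnerApproxWinding` (`innerApprox_deep`), `CollarGeometry`, `CollarDomain`, `ConformalTube`.
-/

noncomputable section

open Set Metric Filter Topology Literature.Probability.LatticeModels Literature.Probability.RandomPlanarGeometry

namespace Literature.Probability.Percolation

variable (R : ConformalRectangle) (T : R.toJordanDomain.TubeData)

/-- **Uniform continuity of the inverse chart on `closure Ω`**: for `λ > 0` there is `g > 0` such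
that points of the closed disc whose images are `g`-close are `λ`-close (the chart is a
homeomorphism of the compact closed disc onto `closure Ω`). [folklore] -/
theorem exists_dist_lt_of_dist_apply_lt (C : R.toJordanDomain.DiscChart) {lam : ℝ} (hlam : 0 < lam) :
    ∃ g > 0, ∀ u₁ ∈ closedBall (0 : ℂ) 1, ∀ u₂ ∈ closedBall (0 : ℂ) 1, dist (C.Φ u₁) (C.Φ u₂) < g → dist u₁ u₂ < lam := by
  haveI : CompactSpace (closedBall (0 : ℂ) 1) := isCompact_iff_compactSpace.1 (isCompact_closedBall 0 1)
  haveI : CompactSpace (closure R.carrier) := isCompact_iff_compactSpace.1 R.isBounded.isCompact_closure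
  set e : closedBall (0 : ℂ) 1 ≃ closure R.carrier := C.bijOn.equiv C.Φ with he
  have hec : Continuous e := (C.continuousOn.mapsToRestrict C.bijOn.mapsTo)
  set H := Continuous.homeoOfEquivCompactToT2 (f := e) hec with hH
  have hu : UniformContinuous H.symm := CompactSpace.uniformContinuous_of_continuous H.symm.continuous
  obtain ⟨g, hg, hgu⟩ := Metric.uniformContinuous_iff.1 hu lam hlam
  refine ⟨g, hg, fun u₁ hu₁ u₂ hu₂ hd => ?_⟩
  have h1 : H.symm (H ⟨u₁, hu₁⟩) = ⟨u₁, hu₁⟩ := H.symm_apply_apply _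
  have h2 : H.symm (H ⟨u₂, hu₂⟩) = ⟨u₂, hu₂⟩ := H.symm_apply_apply _
  have := hgu (a := H ⟨u₁, hu₁⟩) (b := H ⟨u₂, hu₂⟩) hd
  rwa [h1, h2] at this

/-- Signs `±1`: the pattern of the "longer, thinner" domain `D'` (arcs `0`, `2` pushed out).
[cite: BollobasRiordan2006, Ch. 7 p. 186] -/
def σm : Fin 4 → ℝ := ![1, -1, 1, -1]

/-- Signs `±1`: the pattern of the "shorter, fatter" domain `D''` (arcs `1`, `3` pushed out).
[cite: BollobasRiordan2006, Ch. 7 p. 186] -/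
def σp : Fin 4 → ℝ := ![-1, 1, -1, 1]

/-- `σm` is a sign pattern. [folklore] -/
theorem σm_sign : ∀ i, σm i = 1 ∨ σm i = -1 := by
  intro i; fin_cases i <;> simp [σm]

/-- `σp` is a sign pattern. [folklore] -/
theorem σp_sign : ∀ i, σp i = 1 ∨ σp i = -1 := by
  intro i; fin_cases i <;> simp [σp]

/-- **The level-`ε` core.** For a conformal rectangle `R` with boundary of index `1`, tube data
`T`, a sign pattern `σ`, a level `ε > 0`, a corner radius `ρ > 0`, a tolerance cap `tmax > 0`
and an arc–corner separation `carc` of `R`: there are a width `h ∈ (0, ε]` with the collar domain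
`D_σ` of width `h` containing the centre, a threshold `δ₀ > 0` and a tolerance `t ∈ [0, tmax]`
such that for every mesh `δ < δ₀` there is a 4-marked discrete domain `G`, a marked inner
approximation of `D_σ`, with: (arcs) the `i`-th discrete arc and `Aᵢ` mutually within `2ε`;
(H1) sites off `Ω` within `t` of a pushed-out arc; (H2) sites in `Ω` at distance `≥ ρ` from the
corners farther than `δ` from the pulled-in arcs; (H3) sites of pushed-out discrete arcs at
distance `≥ ρ` from the corners off `Ω` and within `t` of their arc; (H4) sites of the `i`-th
discrete arc at distance `> carc - 2ε` from the corners not on `Aᵢ`; (fill) mesh points of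
`Φ(B̄(0, 1 - 2ε))` are sites; (dense) every point of `closure Ω` within `2ε` of a face centre.
[cite: BollobasRiordan2006, Ch. 7 Lemma 14 p. 184, (28)–(29) p. 192, (31)–(34) pp. 196–199] -/
theorem level_core {σ : Fin 4 → ℝ} (hσ1 : ∀ i, σ i = 1 ∨ σ i = -1) (hR1 : ∀ z ∈ R.carrier, R.index z = 1)
    {ε ρ tmax carc : ℝ} (hε : 0 < ε) (hρ : 0 < ρ) (htmax : 0 < tmax)
    (hcarc : ∀ k i, R.pt k ∉ R.arc i → carc ≤ infDist (R.pt k) (R.arc i)) :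
    ∃ (h : ℝ) (hh : 0 < h) (hh1 : h ≤ 1 / 2), h ≤ ε ∧
      T.z₀ ∈ (R.collarRect T (MarkedDomain.abs_le_one_of_sign hσ1) hh hh1).carrier ∧
      ∃ δ₀ > 0, ∃ t, 0 ≤ t ∧ t ≤ tmax ∧ ∀ δ : ℝ, ∀ hδ : 0 < δ, δ < δ₀ →
        ∃ hc₀ : baseSite T.z₀ δ ∈ innerCoarse (R.collarRect T (MarkedDomain.abs_le_one_of_sign hσ1) hh hh1).carrier δ,
        ∃ G : TriMarkedDomain 4,
          G.verts = (innerApprox (R.collarRect T (MarkedDomain.abs_le_one_of_sign hσ1) hh hh1).toJordanDomain hδ hc₀).verts ∧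
          (∀ i : Fin 4, (∀ y ∈ G.arc i, ∃ z ∈ R.arc i, dist (triMeshPoint δ y) z < 2 * ε) ∧
            ∀ z ∈ R.arc i, ∃ y ∈ G.arc i, dist (triMeshPoint δ y) z < 2 * ε) ∧
          (∀ x ∈ G.verts, triMeshPoint δ x ∉ R.carrier → ∃ i, σ i = 1 ∧ infDist (triMeshPoint δ x) (R.arc i) ≤ t) ∧
          (∀ x ∈ G.verts, triMeshPoint δ x ∈ R.carrier → (∀ i, ρ ≤ dist (triMeshPoint δ x) (R.pt i)) →
            ∀ j, σ j = -1 → δ < infDist (triMeshPoint δ x) (R.arc j)) ∧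
          (∀ i, σ i = 1 → ∀ u ∈ G.arc i, (∀ k, ρ ≤ dist (triMeshPoint δ u) (R.pt k)) →
            triMeshPoint δ u ∉ R.carrier ∧ infDist (triMeshPoint δ u) (R.arc i) ≤ t) ∧
          (∀ i, ∀ u ∈ G.arc i, ∀ k, R.pt k ∉ R.arc i → carc - 2 * ε < dist (triMeshPoint δ u) (R.pt k)) ∧
          (∀ x : Site 2, triMeshPoint δ x ∈ T.Ci.Φ '' closedBall (0 : ℂ) (1 - 2 * ε) → x ∈ G.verts) ∧
          (∀ z ∈ closure R.carrier, ∃ w ∈ G.faces, dist z ((δ : ℂ) * hexCenter w) < 2 * ε) := by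
  classical
  have hσ := MarkedDomain.abs_le_one_of_sign hσ1
  -- constants of `R` and `T`
  have hd₀ := R.toJordanDomain.infDist_frontier_pos T.hz₀
  set d₀ := infDist T.z₀ (frontier R.carrier) with hd₀def
  obtain ⟨ηc, hηc0, hηc⟩ := R.exists_corner_modulus (half_pos hρ)
  -- the tube tolerance
  set tol := min (min ε (d₀ / 2)) (min (tmax / 2) (min (ρ / 8) (ηc / 2))) with htol
  have htol0 : 0 < tol := by simp only [htol, lt_min_iff]; exact ⟨⟨hε, by linarith⟩, by linarith, by linarith, by linarith⟩
  have htolε : tol ≤ ε := (min_le_left _ _).trans (min_le_left _ _)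
  have htold : tol ≤ d₀ / 2 := (min_le_left _ _).trans (min_le_right _ _)
  have htolt : tol ≤ tmax / 2 := (min_le_right _ _).trans (min_le_left _ _)
  have htolρ : tol ≤ ρ / 8 := (min_le_right _ _).trans ((min_le_right _ _).trans (min_le_left _ _))
  have htolη : tol ≤ ηc / 2 := (min_le_right _ _).trans ((min_le_right _ _).trans (min_le_right _ _))
  -- the width
  obtain ⟨h₁, hh₁, hh₁1, hdist₁⟩ := T.exists_dist_tube_lt htol0
  obtain ⟨ηΦ, hηΦ, hΦuc⟩ := Metric.uniformContinuousOn_iff.1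
    ((isCompact_closedBall (0 : ℂ) 1).uniformContinuousOn_of_continuous T.Ci.continuousOn) ε hε
  set h := min h₁ (min ε (ηΦ / 3)) with hhdef
  have hh : 0 < h := lt_min hh₁ (lt_min hε (by linarith))
  have hhh₁ : h ≤ h₁ := min_le_left _ _
  have hh1 : h ≤ 1 / 2 := hhh₁.trans hh₁1
  have hhε : h ≤ ε := (min_le_right _ _).trans (min_le_left _ _)
  have hhΦ : h ≤ ηΦ / 3 := (min_le_right _ _).trans (min_le_right _ _)
  have hdist : ∀ s t, 1 - h ≤ s → s ≤ 1 + h → dist (T.tube s t) (R.boundary t) < tol := fun s t hs hs' =>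
    hdist₁ s t (by linarith) (by linarith)
  -- the collar domain
  set D := R.collarRect T hσ hh hh1 with hD
  have hclose : ∀ t, dist (R.collarLoop T σ h t) (R.boundary t) < infDist T.z₀ (frontier R.carrier) := fun t => by
    have := R.profile_mem hσ hh t
    exact (hdist _ _ (by linarith [this.1]) (by linarith [this.2])).trans_le (by linarith)
  have hz₀ : T.z₀ ∈ D.carrier := R.z₀_mem_collarRect T hσ hh hh1 hclose
  have hind : ∀ z ∈ D.carrier, D.index z = 1 := fun z hz => by
    rw [hD, R.index_collarRect T hσ hh hh1 hclose hz]; exact hR1 _ T.hz₀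
  -- the two separation constants
  obtain ⟨m, hm, hpull⟩ := R.exists_le_infDist_arc_of_mem_collar T hσ1 hh hh1 hρ hηc (by linarith) (by linarith) hdist
  obtain ⟨m', hm', hpush⟩ := R.exists_le_infDist_closure_of_mem_arc T hσ1 hh hh1 (half_pos hρ) (by linarith) hdist
  -- the marks tolerance and the marked inner approximations
  set εm := min (min ε (m' / 2)) (min (tmax / 2) (ρ / 2)) with hεm
  have hεm0 : 0 < εm := by simp only [hεm, lt_min_iff]; exact ⟨⟨hε, by linarith⟩, by linarith, by linarith⟩
  have hεmε : εm ≤ ε := (min_le_left _ _).trans (min_le_left _ _)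
  have hεmm' : εm ≤ m' / 2 := (min_le_left _ _).trans (min_le_right _ _)
  have hεmt : εm ≤ tmax / 2 := (min_le_right _ _).trans (min_le_left _ _)
  have hεmρ : εm ≤ ρ / 2 := (min_le_right _ _).trans (min_le_right _ _)
  obtain ⟨δA, hδA, hmarks⟩ := exists_marked_innerApprox D hind hz₀ hεm0
  -- the swallowed compact `K' = Φ(B̄(0, 1 - 3h/2))`
  set K' := T.Ci.Φ '' closedBall (0 : ℂ) (1 - 3 / 2 * h) with hK'
  have hK'c : IsCompact K' := (isCompact_closedBall _ _).image_of_continuousOn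
    (T.Ci.continuousOn.mono (closedBall_subset_closedBall (by linarith)))
  have hK'D : K' ⊆ D.carrier := by
    rintro _ ⟨u, hu, rfl⟩
    exact R.apply_mem_collarRect T hσ hh hh1 hclose ((mem_closedBall_zero_iff.1 hu).trans_lt (by linarith))
  obtain ⟨δB, hδB, hswallow⟩ := exists_forall_mem_innerApprox D.toJordanDomain hz₀ hK'c hK'D
  -- depth of `K'' = Φ(B̄(0, 1 - 2h))` inside `Ω`, and the inverse-chart gap
  obtain ⟨m₂, hm₂, hdeep⟩ := T.exists_le_infDist_tube_inner (h := 3 / 2 * h) (by positivity) (by linarith)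
  obtain ⟨g, hg, hgap⟩ := exists_dist_lt_of_dist_apply_lt R T.Ci (half_pos hh)
  -- the threshold
  refine ⟨h, hh, hh1, hhε, hz₀, min δA (min δB (min m (min (m₂ / 2) (min (g / 2) (ε / 2))))), by positivity,
    εm + tol, by positivity, by linarith, fun δ hδ hδlt => ?_⟩
  have hδA' : δ < δA := hδlt.trans_le (min_le_left _ _)
  have hδB' : δ < δB := hδlt.trans_le ((min_le_right _ _).trans (min_le_left _ _))
  have hδm : δ < m := hδlt.trans_le ((min_le_right _ _).trans ((min_le_right _ _).trans (min_le_left _ _)))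
  have hδm₂ : δ < m₂ / 2 := hδlt.trans_le ((min_le_right _ _).trans ((min_le_right _ _).trans ((min_le_right _ _).trans (min_le_left _ _))))
  have hδg : δ < g / 2 := hδlt.trans_le ((min_le_right _ _).trans ((min_le_right _ _).trans ((min_le_right _ _).trans
    ((min_le_right _ _).trans (min_le_left _ _)))))
  have hδε : δ < ε / 2 := hδlt.trans_le ((min_le_right _ _).trans ((min_le_right _ _).trans ((min_le_right _ _).trans
    ((min_le_right _ _).trans (min_le_right _ _)))))
  obtain ⟨hc₀, G, hGv, hGarcs⟩ := hmarks δ hδ hδA'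
  obtain ⟨_, hK⟩ := hswallow δ hδ hδB'
  have hGdeep : ∀ x ∈ G.verts, triMeshPoint δ x ∈ D.carrier := fun x hx => by
    rw [hGv] at hx
    exact innerApprox_deep D.toJordanDomain hδ hc₀ x hx (mem_closedBall_self (by positivity))
  have harcR := R.arc_close T hσ1 hh hh1 hdist
  refine ⟨hc₀, G, hGv, fun i => ⟨fun y hy => ?_, fun z hz => ?_⟩, fun x hx hxΩ => ?_, fun x hx hxΩ hfar j hσj => ?_,
    fun i hσi u hu hfar => ?_, fun i u hu k hk => ?_, fun x hx => ?_, fun z hz => ?_⟩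
  · -- discrete arc near `A_i`
    obtain ⟨y', hy', hd1⟩ := (hGarcs i).1 y hy
    obtain ⟨z, hz, hd2⟩ := (harcR i).1 y' hy'
    exact ⟨z, hz, by have := dist_triangle (triMeshPoint δ y) y' z; linarith⟩
  · -- `A_i` near the discrete arc
    obtain ⟨y', hy', hd1⟩ := (harcR i).2 z hz
    obtain ⟨y, hy, hd2⟩ := (hGarcs i).2 y' hy'
    exact ⟨y, hy, by have := dist_triangle (triMeshPoint δ y) y' z; linarith⟩
  · -- (H1)
    obtain ⟨i, hσi, q, hq, hd⟩ := R.exists_arc_of_mem_collar_not_mem T hσ1 hh hh1 hdist (hGdeep x hx) hxΩ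
    exact ⟨i, hσi, (infDist_le_dist_of_mem hq).trans (by linarith)⟩
  · -- (H2)
    exact hδm.trans_le (hpull _ (hGdeep x hx) hxΩ hfar j hσj)
  · -- (H3)
    obtain ⟨y, hy, hd⟩ := (hGarcs i).1 u hu
    have hyfar : ∀ k, ρ / 2 ≤ dist y (R.pt k) := fun k => by
      have := dist_triangle (triMeshPoint δ u) y (R.pt k); linarith [hfar k]
    have hy_out := hpush i hσi y hy hyfar
    refine ⟨fun huΩ => ?_, ?_⟩
    · have h1 : infDist y (closure R.carrier) ≤ dist y (triMeshPoint δ u) := infDist_le_dist_of_mem (subset_closure huΩ)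
      rw [dist_comm] at h1
      linarith
    · obtain ⟨z, hz, hd2⟩ := (harcR i).1 y hy
      have := infDist_le_dist_of_mem (x := triMeshPoint δ u) hz
      have := dist_triangle (triMeshPoint δ u) y z
      linarith
  · -- (H4)
    obtain ⟨y, hy, hd⟩ := (hGarcs i).1 u hu
    obtain ⟨z, hz, hd2⟩ := (harcR i).1 y hy
    have h1 := hcarc k i hk
    have h2 : infDist (R.pt k) (R.arc i) ≤ dist (R.pt k) z := infDist_le_dist_of_mem hz
    have := dist_triangle4 (R.pt k) (triMeshPoint δ u) y z
    rw [dist_comm (R.pt k) (triMeshPoint δ u)] at this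
    linarith
  · -- (fill)
    rw [hGv]
    refine hK x ?_
    obtain ⟨u, hu, hux⟩ := hx
    exact ⟨u, closedBall_subset_closedBall (by linarith) hu, hux⟩
  · -- (dense)
    obtain ⟨u, hu, rfl⟩ := T.Ci.bijOn.surjOn hz
    have hu1 := mem_closedBall_zero_iff.1 hu
    set u' : ℂ := ((1 - 2 * h : ℝ) : ℂ) * u with hu'
    have hu'n : ‖u'‖ ≤ 1 - 2 * h := by
      rw [hu', norm_mul, Complex.norm_real, Real.norm_eq_abs, abs_of_nonneg (by linarith)]; nlinarith [norm_nonneg u]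
    have hu'1 : u' ∈ closedBall (0 : ℂ) 1 := mem_closedBall_zero_iff.2 (by linarith)
    have hzz' : dist (T.Ci.Φ u) (T.Ci.Φ u') < ε := by
      refine hΦuc u hu u' hu'1 ?_
      rw [dist_eq_norm, show u - u' = ((2 * h : ℝ) : ℂ) * u by rw [hu']; push_cast; ring, norm_mul, Complex.norm_real,
        Real.norm_eq_abs, abs_of_pos (by positivity)]
      nlinarith [norm_nonneg u]
    -- `z' = Φ u'` is deep: it is `tube ‖u'‖ t` … we only need its distance to the boundary, through `K''`
    have hz'deep : m₂ ≤ infDist (T.Ci.Φ u') (frontier R.carrier) := by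
      -- write `u' = ‖u'‖ β t`
      rcases eq_or_ne u' 0 with h0 | hu'0
      · rw [h0, T.Ci_zero]
        have := hdeep 0 0 (by rw [abs_zero]; linarith)
        rwa [T.tube_of_le_one zero_le_one, Complex.ofReal_zero, zero_mul, T.Ci_zero] at this
      · have hn : 0 < ‖u'‖ := norm_pos_iff.2 hu'0
        set v : ℂ := ((‖u'‖⁻¹ : ℝ) : ℂ) * u' with hv
        have hv1 : ‖v‖ = 1 := by
          rw [hv, norm_mul, Complex.norm_real, Real.norm_eq_abs, abs_of_pos (inv_pos.2 hn), inv_mul_cancel₀ hn.ne']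
        obtain ⟨t, ht⟩ : ∃ t, T.Ci.β t = v := by
          have hfr : T.Ci.Φ v ∈ frontier R.carrier := T.Ci.apply_mem_frontier hv1
          rw [← R.range_boundary] at hfr
          obtain ⟨t, ht⟩ := hfr
          refine ⟨t, T.Ci.injOn (mem_closedBall_zero_iff.2 (T.Ci.norm_β t).le) (mem_closedBall_zero_iff.2 hv1.le) ?_⟩
          rw [T.Ci.apply_β]; exact ht
        have hu'' : u' = ((‖u'‖ : ℝ) : ℂ) * T.Ci.β t := by
          rw [ht, hv, ← mul_assoc, ← Complex.ofReal_mul, mul_inv_cancel₀ hn.ne', Complex.ofReal_one, one_mul]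
        have := hdeep ‖u'‖ t (by rw [abs_of_pos hn]; linarith)
        rwa [T.tube_of_le_one (by linarith), ← hu''] at this
    -- the face containing `z'`
    obtain ⟨F, hFv, hFc⟩ := exists_face_near hδ (T.Ci.Φ u')
    refine ⟨F, ?_, ?_⟩
    · rw [TriMarkedDomain.mem_faces, hGv]
      intro v hv
      apply hK
      -- `pt v` is in `Ω`, and its chart preimage is within `h/2` of `u'`
      have hvΩ : triMeshPoint δ v ∈ R.carrier := by
        have hz'Ω : T.Ci.Φ u' ∈ R.carrier := T.Ci.apply_mem_carrier (by linarith)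
        refine closedBall_subset_of_lt_infDist_frontier R.isOpen hz'Ω (r := δ) (by linarith) (mem_closedBall.2 ?_)
        rw [dist_comm]; exact hFv v hv
      obtain ⟨u₂, hu₂, hu₂v⟩ := T.Ci.bijOn_ball.surjOn hvΩ
      refine ⟨u₂, mem_closedBall_zero_iff.2 ?_, hu₂v⟩
      have hd : dist (T.Ci.Φ u₂) (T.Ci.Φ u') < g := by
        rw [hu₂v, dist_comm]; exact (hFv v hv).trans_lt (by linarith)
      have := hgap u₂ (ball_subset_closedBall hu₂) u' hu'1 hd
      rw [dist_eq_norm] at this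
      have := norm_le_of_mem_closedBall (mem_closedBall_zero_iff.2 hu'n)
      calc ‖u₂‖ = ‖(u₂ - u') + u'‖ := by rw [sub_add_cancel]
        _ ≤ ‖u₂ - u'‖ + ‖u'‖ := norm_add_le _ _
        _ ≤ 1 - 3 / 2 * h := by linarith
    · have := dist_triangle (T.Ci.Φ u) (T.Ci.Φ u') (meshCenter δ F)
      rw [dist_comm (T.Ci.Φ u') (meshCenter δ F)] at this
      show dist (T.Ci.Φ u) (meshCenter δ F) < 2 * ε
      linarith

end Literature.Probability.Percolation
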